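import Literature.NumberTheory.EllipticCurves.SecondKindSeriesValueCocycle
import HarnessLib

/-!
# The Colmez functional of a series of the second kind along a `[p]_W`-division tower:
# `‖G([n]_W t) − n·G(t)‖ ≤ C`, and `pⁿ·G(wₙ)` converges with rate `‖p‖ⁿ·C` when `[p]_W w_{n+1} = wₙ`

Topic `Literature/NumberTheory/EllipticCurves`; namespace `Literature.NumberTheory.EllipticCurves`. THEOREMS ONLY (no definition, no named fact,
no instance, no `sorry`). Setting as in `SecondKindSeriesValueCocycle` (J1): `K` complete nontrivially normed ultrametric, `W/ℤ`, `G = Σ cₙXⁿ ∈ K⟦X⟧`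
with `c₀ = 0`, `‖cₙ‖ ≤ n^k`, `F_W`-coboundary coefficients `≤ C`; `G(x) := Σ' cₙxⁿ`; `[n]_W t` the value of `W.formalMul n` at `t ∈ 𝔪_K`.

* §1 ★ `norm_tsum_formalMul_sub_nsmul_le` — **`‖G([n]_W t) − n·G(t)‖ ≤ C`** for `n ≥ 1` (`[n+1] = F_W([n], X)`, tree `Pt.evalPt₁_formalMul_succ`, and J1).
* §2 For a `[p]_W`-division tower `w` (`[p]_W w_{n+1} = wₙ`) and `aₙ := pⁿ·G(wₙ)`: `norm_pow_succ_mul_tsum_sub_le` (`‖a_{n+1} − aₙ‖ ≤ ‖p‖ⁿ·C`),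
  `norm_pow_add_mul_tsum_sub_le` (`‖a_{n+m} − aₙ‖ ≤ ‖p‖ⁿ·C`), ★★ `exists_tendsto_pow_mul_tsum` — if `‖p‖ < 1` the **Colmez functional
  `𝒞_w(G) = lim pⁿG(wₙ)` exists and `‖𝒞_w(G) − pⁿG(wₙ)‖ ≤ ‖p‖ⁿ·C`** (in particular `𝒞_w(G) = G(w₀)` up to `C`).

Purpose (crux K★ `stmt-BirchSwinnertonDyer-22226`, line `kato_lever`, memo `Lines/kato-lever-K2-ramified-cm-transport.md` §9, step J2): the θ-evaluation of the
transported periods (HL-eval) is `log_{W_D}(u₀) = A·𝒞_{Tu}(log_{E₀}) + B·𝒞_{Tu}(log_{E₀}(Xᵖ))`; this file supplies the functional and its rate for ANY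
second-kind `G` along exact `E₀`-towers. Infrastructure only; BSD / K★ are not proved by any of this.

## References
* N. M. Katz, *Crystalline cohomology, Dieudonné modules, and Jacobi sums* (1981), §5.1, Key Lemma 5.1.3. [Katz1981CrystallineDieudonne]
* J. H. Silverman, *The Arithmetic of Elliptic Curves* (2009), IV.2.3, Thm. IV.6.4. [SilvermanAEC2009]
-/

noncomputable section

open scoped Classical Topology
open PowerSeries Filter Finset

namespace Literature.NumberTheory.EllipticCurves

open Literature.NumberTheory.GaloisRepresentations.LubinTate

variable {K : Type*} [NontriviallyNormedField K] [IsUltrametricDist K] [CompleteSpace K]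

/-! ## §1 `G([n]t) ≡ n·G(t)` up to `C` -/

/-- ★ **`‖G([n]_W t) − n·G(t)‖ ≤ C` for `n ≥ 1`**: induction on `n` with `[n+1]_W t = F_W([n]_W t, t)` and the value cocycle bound (J1).
[cite: Katz1981CrystallineDieudonne, §5.1, Key Lemma 5.1.3] [cite: SilvermanAEC2009, IV.2.3] -/
theorem norm_tsum_formalMul_sub_nsmul_le (W : WeierstrassCurve ℤ) (G : PowerSeries K) (hG0 : PowerSeries.constantCoeff G = 0) (k : ℕ)
    (hk : ∀ n, ‖PowerSeries.coeff n G‖ ≤ (n : ℝ) ^ k) {C : ℝ} (hC0 : 0 ≤ C)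
    (hC : ∀ d : Fin 2 →₀ ℕ, ‖MvPowerSeries.coeff d (G.subst (W.map (Int.castRingHom K)).formalGroupLaw -
      G.subst (MvPowerSeries.X 0 : MvPowerSeries (Fin 2) K) - G.subst (MvPowerSeries.X 1 : MvPowerSeries (Fin 2) K))‖ ≤ C)
    (t : (ballNilIdeal K).toIdeal) {n : ℕ} (hn : 1 ≤ n) :
    ‖∑' m : ℕ, PowerSeries.coeff m G *
          (((evalPt₁ (ballNilIdeal K) (W.formalMul n) (W.constantCoeff_formalMul n) t : (ballNilIdeal K).toIdeal) : unitBall K) : K) ^ m -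
        (n : K) * ∑' m : ℕ, PowerSeries.coeff m G * ((t : unitBall K) : K) ^ m‖ ≤ C := by
  induction n, hn using Nat.le_induction with
  | base =>
    have h1 : evalPt₁ (ballNilIdeal K) (W.formalMul 1) (W.constantCoeff_formalMul 1) t = t := by
      have h := (WeierstrassCurve.Pt.val_nsmul 1 (⟨t⟩ : W.Pt (ballNilIdeal K))).symm
      rwa [one_nsmul] at h
    rw [h1, Nat.cast_one, one_mul, sub_self, norm_zero]
    exact hC0
  | succ n hn ih =>
    rw [WeierstrassCurve.Pt.evalPt₁_formalMul_succ, show addPt (ballNilIdeal K) W.toFormalGroup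
        (evalPt₁ (ballNilIdeal K) (W.formalMul n) (W.constantCoeff_formalMul n) t) t =
        evF W (evalPt₁ (ballNilIdeal K) (W.formalMul n) (W.constantCoeff_formalMul n) t) t from rfl]
    have hJ1 := norm_tsum_evF_sub_tsum_sub_tsum_le W G hG0 k hk hC0 hC
      (evalPt₁ (ballNilIdeal K) (W.formalMul n) (W.constantCoeff_formalMul n) t) t
    -- `G([n+1]t) − (n+1)G(t) = (G(F([n]t,t)) − G([n]t) − G(t)) + (G([n]t) − nG(t))`
    have hsplit : ∀ a b c : K, a - ((n + 1 : ℕ) : K) * c = (a - b - c) + (b - (n : K) * c) := fun a b c => by push_cast; ring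
    rw [hsplit _ (∑' m : ℕ, PowerSeries.coeff m G *
      (((evalPt₁ (ballNilIdeal K) (W.formalMul n) (W.constantCoeff_formalMul n) t : (ballNilIdeal K).toIdeal) : unitBall K) : K) ^ m)]
    exact (IsUltrametricDist.norm_add_le_max _ _).trans (max_le hJ1 ih)

/-! ## §2 The Colmez functional along a `[p]_W`-division tower -/

/-- **One step: `‖p^{n+1}G(w_{n+1}) − pⁿG(wₙ)‖ ≤ ‖p‖ⁿ·C`** when `[p]_W w_{n+1} = wₙ` (§1 with `n = p`).
[cite: Katz1981CrystallineDieudonne, §5.1] -/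
theorem norm_pow_succ_mul_tsum_sub_le (W : WeierstrassCurve ℤ) (G : PowerSeries K) (hG0 : PowerSeries.constantCoeff G = 0) (k : ℕ)
    (hk : ∀ n, ‖PowerSeries.coeff n G‖ ≤ (n : ℝ) ^ k) {C : ℝ} (hC0 : 0 ≤ C)
    (hC : ∀ d : Fin 2 →₀ ℕ, ‖MvPowerSeries.coeff d (G.subst (W.map (Int.castRingHom K)).formalGroupLaw -
      G.subst (MvPowerSeries.X 0 : MvPowerSeries (Fin 2) K) - G.subst (MvPowerSeries.X 1 : MvPowerSeries (Fin 2) K))‖ ≤ C)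
    {p : ℕ} (hp : 1 ≤ p) (w : ℕ → (ballNilIdeal K).toIdeal)
    (hw : ∀ n, evalPt₁ (ballNilIdeal K) (W.formalMul p) (W.constantCoeff_formalMul p) (w (n + 1)) = w n) (n : ℕ) :
    ‖(p : K) ^ (n + 1) * ∑' m : ℕ, PowerSeries.coeff m G * ((w (n + 1) : unitBall K) : K) ^ m -
        (p : K) ^ n * ∑' m : ℕ, PowerSeries.coeff m G * ((w n : unitBall K) : K) ^ m‖ ≤ ‖(p : K)‖ ^ n * C := by
  have h := norm_tsum_formalMul_sub_nsmul_le W G hG0 k hk hC0 hC (w (n + 1)) hp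
  rw [hw n] at h
  have hfac : (p : K) ^ (n + 1) * ∑' m : ℕ, PowerSeries.coeff m G * ((w (n + 1) : unitBall K) : K) ^ m -
      (p : K) ^ n * ∑' m : ℕ, PowerSeries.coeff m G * ((w n : unitBall K) : K) ^ m =
      -((p : K) ^ n * (∑' m : ℕ, PowerSeries.coeff m G * ((w n : unitBall K) : K) ^ m -
        (p : K) * ∑' m : ℕ, PowerSeries.coeff m G * ((w (n + 1) : unitBall K) : K) ^ m)) := by ring
  rw [hfac, norm_neg, norm_mul, norm_pow]
  exact mul_le_mul_of_nonneg_left h (pow_nonneg (norm_nonneg _) n)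

/-- **Telescoping: `‖p^{n+m}G(w_{n+m}) − pⁿG(wₙ)‖ ≤ ‖p‖ⁿ·C`** (ultrametric, `‖p‖ ≤ 1`). [cite: Katz1981CrystallineDieudonne, §5.1] -/
theorem norm_pow_add_mul_tsum_sub_le (W : WeierstrassCurve ℤ) (G : PowerSeries K) (hG0 : PowerSeries.constantCoeff G = 0) (k : ℕ)
    (hk : ∀ n, ‖PowerSeries.coeff n G‖ ≤ (n : ℝ) ^ k) {C : ℝ} (hC0 : 0 ≤ C)
    (hC : ∀ d : Fin 2 →₀ ℕ, ‖MvPowerSeries.coeff d (G.subst (W.map (Int.castRingHom K)).formalGroupLaw -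
      G.subst (MvPowerSeries.X 0 : MvPowerSeries (Fin 2) K) - G.subst (MvPowerSeries.X 1 : MvPowerSeries (Fin 2) K))‖ ≤ C)
    {p : ℕ} (hp : 1 ≤ p) (w : ℕ → (ballNilIdeal K).toIdeal)
    (hw : ∀ n, evalPt₁ (ballNilIdeal K) (W.formalMul p) (W.constantCoeff_formalMul p) (w (n + 1)) = w n) (n m : ℕ) :
    ‖(p : K) ^ (n + m) * ∑' j : ℕ, PowerSeries.coeff j G * ((w (n + m) : unitBall K) : K) ^ j -
        (p : K) ^ n * ∑' j : ℕ, PowerSeries.coeff j G * ((w n : unitBall K) : K) ^ j‖ ≤ ‖(p : K)‖ ^ n * C := by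
  have hp1 : ‖(p : K)‖ ≤ 1 := IsUltrametricDist.norm_natCast_le_one K p
  induction m with
  | zero => rw [add_zero, sub_self, norm_zero]; positivity
  | succ m ih =>
    have hstep := norm_pow_succ_mul_tsum_sub_le W G hG0 k hk hC0 hC hp w hw (n + m)
    have hsplit : (p : K) ^ (n + (m + 1)) * ∑' j : ℕ, PowerSeries.coeff j G * ((w (n + (m + 1)) : unitBall K) : K) ^ j -
        (p : K) ^ n * ∑' j : ℕ, PowerSeries.coeff j G * ((w n : unitBall K) : K) ^ j =
        ((p : K) ^ (n + m + 1) * ∑' j : ℕ, PowerSeries.coeff j G * ((w (n + m + 1) : unitBall K) : K) ^ j -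
          (p : K) ^ (n + m) * ∑' j : ℕ, PowerSeries.coeff j G * ((w (n + m) : unitBall K) : K) ^ j) +
        ((p : K) ^ (n + m) * ∑' j : ℕ, PowerSeries.coeff j G * ((w (n + m) : unitBall K) : K) ^ j -
          (p : K) ^ n * ∑' j : ℕ, PowerSeries.coeff j G * ((w n : unitBall K) : K) ^ j) := by
      rw [← add_assoc]; ring
    rw [hsplit]
    refine (IsUltrametricDist.norm_add_le_max _ _).trans (max_le (hstep.trans ?_) ih)
    rw [pow_add]
    exact mul_le_mul_of_nonneg_right (mul_le_of_le_one_right (pow_nonneg (norm_nonneg _) n) (pow_le_one₀ (norm_nonneg _) hp1))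
      hC0

/-- ★★ **The Colmez functional exists**: if `‖p‖ < 1` in `K`, then for every `[p]_W`-division tower `w` the sequence `pⁿ·G(wₙ)` converges to a
limit `𝒞_w(G)` with **`‖𝒞_w(G) − pⁿ·G(wₙ)‖ ≤ ‖p‖ⁿ·C`** for all `n` (so `‖𝒞_w(G) − G(w₀)‖ ≤ C`).
[cite: Katz1981CrystallineDieudonne, §5.1, Key Lemma 5.1.3] -/
theorem exists_tendsto_pow_mul_tsum (W : WeierstrassCurve ℤ) (G : PowerSeries K) (hG0 : PowerSeries.constantCoeff G = 0) (k : ℕ)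
    (hk : ∀ n, ‖PowerSeries.coeff n G‖ ≤ (n : ℝ) ^ k) {C : ℝ} (hC0 : 0 ≤ C)
    (hC : ∀ d : Fin 2 →₀ ℕ, ‖MvPowerSeries.coeff d (G.subst (W.map (Int.castRingHom K)).formalGroupLaw -
      G.subst (MvPowerSeries.X 0 : MvPowerSeries (Fin 2) K) - G.subst (MvPowerSeries.X 1 : MvPowerSeries (Fin 2) K))‖ ≤ C)
    {p : ℕ} (hp : 1 ≤ p) (hp1 : ‖(p : K)‖ < 1) (w : ℕ → (ballNilIdeal K).toIdeal)
    (hw : ∀ n, evalPt₁ (ballNilIdeal K) (W.formalMul p) (W.constantCoeff_formalMul p) (w (n + 1)) = w n) :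
    ∃ L : K, Tendsto (fun n : ℕ => (p : K) ^ n * ∑' j : ℕ, PowerSeries.coeff j G * ((w n : unitBall K) : K) ^ j) atTop (𝓝 L) ∧
      ∀ n : ℕ, ‖L - (p : K) ^ n * ∑' j : ℕ, PowerSeries.coeff j G * ((w n : unitBall K) : K) ^ j‖ ≤ ‖(p : K)‖ ^ n * C := by
  set a : ℕ → K := fun n => (p : K) ^ n * ∑' j : ℕ, PowerSeries.coeff j G * ((w n : unitBall K) : K) ^ j with ha
  have hdist : ∀ n m, n ≤ m → ‖a m - a n‖ ≤ ‖(p : K)‖ ^ n * C := by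
    intro n m hnm
    obtain ⟨d, rfl⟩ := Nat.exists_eq_add_of_le hnm
    exact norm_pow_add_mul_tsum_sub_le W G hG0 k hk hC0 hC hp w hw n d
  have hrate : Tendsto (fun n : ℕ => ‖(p : K)‖ ^ n * C) atTop (𝓝 0) := by
    have h := (tendsto_pow_atTop_nhds_zero_of_lt_one (norm_nonneg _) hp1).mul_const C
    rwa [zero_mul] at h
  have hcauchy : CauchySeq a := by
    refine Metric.cauchySeq_iff'.2 fun ε hε => ?_
    obtain ⟨N, hN⟩ := (Metric.tendsto_atTop.1 hrate) ε hε
    refine ⟨N, fun m hm => ?_⟩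
    have hNN := hN N le_rfl
    rw [Real.dist_eq, sub_zero, abs_of_nonneg (by positivity)] at hNN
    rw [dist_eq_norm]
    exact (hdist N m hm).trans_lt hNN
  obtain ⟨L, hL⟩ := cauchySeq_tendsto_of_complete hcauchy
  refine ⟨L, hL, fun n => ?_⟩
  have hlim : Tendsto (fun m => ‖a m - a n‖) atTop (𝓝 ‖L - a n‖) := (hL.sub tendsto_const_nhds).norm
  exact le_of_tendsto hlim (Filter.eventually_atTop.2 ⟨n, fun m hm => hdist n m hm⟩)

end Literature.NumberTheory.EllipticCurves
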